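import Literature.NumberTheory.LFunctions.BaezDuarteMoebiusConvOscillationProofs
import Mathlib.NumberTheory.ArithmeticFunction.Misc
import Mathlib.NumberTheory.Harmonic.EulerMascheroni
import HarnessLib

/-!
# RH-CRITERION LITERATURE (finding) · Báez-Duarte 2005, IJMMS Prop. 4.3 AS PRINTED is equivalent to `¬RH`: the explicit Mellin-proper test function `φ₀ = Σ_n k(x/n)/n`, `k = 𝟙_{[1,2)} − 𝟙_{[2,4)}`, has `Gφ₀ ≡ 0` on `[4, ∞)` — nothing here bears on the truth of RH

L. Báez-Duarte, *Möbius-convolutions and the Riemann hypothesis*, IJMMS 2005:22, 3599–3608,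
**Prop. 4.3** (p. 3607): "If `φ` is Mellin-proper, then `Gφ(x) ≠ o(x^{−1/2})`." The tree proves the
statement under the tacit hypotheses of its printed proof (`BaezDuarte2005Moebius_prop_4_3`:
`N_{−1/2}(φ) < ∞`, `φ^∧ ≠ 0` on `σ = −1/2`) and, unconditionally, that the hypothesis-free form holds
for every Mellin-proper `φ` as soon as RH fails (`BaezDuarte2005Moebius_prop_4_3_of_not_riemannHypothesis`).
This file settles the hypothesis-free form: it is EQUIVALENT TO `¬RH`
(`BaezDuarte2005Moebius_prop_4_3_asPrinted_iff_not_riemannHypothesis`). The witness is explicit: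

* `kern = 𝟙_{[1,2)} − 𝟙_{[2,4)}` (so `∫₀^∞ k(v) dv/v = log 2 − log 2 = 0`) and
  `phi0 x = Σ_{1 ≤ n ≤ x} k(x/n)/n` (`= H_{⌊x⌋} − 2H_{⌊x/2⌋} + H_{⌊x/4⌋}`, harmonic numbers); `φ₀`
  vanishes on `(0,1)`, is bounded by `64/x`, hence is PROPER (`isMoebiusProper_phi0`).
* **Möbius unfolding** (RH-free): `Gφ₀(x) = ∫₀^∞ g(x/u) φ₀(u) du/u = ∫₁^4 𝟙[v ≤ x] k(v) dv/v`, by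
  `Σ_{n ≤ y} g(y/n)/n = 1` (`y ≥ 1`; Möbius inversion `Σ_{d|k} μ(d) = [k = 1]`); in particular
  **`Gφ₀(x) = 0` for `x ≥ 4`** (`moebiusConv_phi0_eq_zero`), so `Gφ₀ = o(x^{−1/2})` trivially.
* **`φ₀^∧(s) = (1 − 2^{−s})² ζ(s+1)/s` on `−1/2 < Re s < 0`** (RH-free; the tree's (3.11)
  `(Gφ)^∧ · sζ(s+1) = φ^∧` for proper `φ` with `Gφ ≪ x^{−1/2+ε}`, and `(Gφ₀)^∧(s) = (1−2^{−s})²/s²`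
  by Fubini on `[1,4]²`), whence **`φ₀` is Mellin-proper iff RH** (`isMellinProper_phi0_iff`): the
  zeros of `φ₀^∧` in the strip are exactly the `ρ − 1`, `ρ` an off-line zero of `ζ`.
* Hence, under RH, `φ₀` is a Mellin-proper function with `Gφ₀ = o(x^{−1/2})`, contradicting the
  printed Prop. 4.3; with the `¬RH` half already in the tree, the printed statement (universally
  quantified over Mellin-proper `φ`) is equivalent to `¬RH`.

* §7 (RH-free): the formula for `φ₀^∧` persists on `−1 < Re s < 0` (identity theorem), so
  `φ₀^∧(ρ − 1) = 0` at every zero `ρ` of `ζ` in the critical strip; at the tree's certified first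
  critical zero this puts a zero of `φ₀^∧` ON the line `σ = −1/2`, unconditionally
  (`exists_leftMellin_phi0_eq_zero_of_re_eq_neg_half`): `φ₀` satisfies the norm hypothesis
  `N_{−1/2}(φ₀) < ∞` of `BaezDuarte2005Moebius_prop_4_3` but violates its line hypothesis
  `φ^∧ ≠ 0` on `σ = −1/2` (`not_forall_leftMellin_phi0_ne_zero_of_re_eq_neg_half`).

FINDING OF RECORD (literature audit, not a claim about RH): the printed Prop. 4.3 needs the
hypotheses used in its proof; as printed it is refutable under RH by `φ₀`. Everything is PROVED;
definitions `kern`, `phi0`, `harmR`, `invAF`, `moebiusDivAF` (plumbing); no named facts.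
Nothing here bears on the truth of RH.

## References

* L. Báez-Duarte, IJMMS 2005:22, §3 Lemma 3.4 (3.12) [(3.11) arXiv], §4 Prop. 4.3 (p. 3607),
  Thm. 3.5 [BaezDuarte2005Moebius].
* E. C. Titchmarsh, *The Theory of the Riemann Zeta-Function*, 2nd ed., §14.25
  [Titchmarsh1986].
-/

noncomputable section

open Filter Asymptotics MeasureTheory Set Real Finset
open scoped Topology ArithmeticFunction.Moebius

namespace Literature.NumberTheory.LFunctions

namespace BaezDuarteProp43

/-! ## §1 The kernel `k = 𝟙_{[1,2)} − 𝟙_{[2,4)}` and the test function `φ₀(x) = Σ_{n ≤ x} k(x/n)/n` -/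

/-- `k = 𝟙_{[1,2)} − 𝟙_{[2,4)}`. [cite: BaezDuarte2005Moebius, §4 Prop. 4.3 (test kernel for the hypothesis-free statement)] -/
def kern (v : ℝ) : ℝ :=
  (Set.Ico (1 : ℝ) 2).indicator (fun _ ↦ (1 : ℝ)) v - (Set.Ico (2 : ℝ) 4).indicator (fun _ ↦ (1 : ℝ)) v

/-- `φ₀(x) = Σ_{1 ≤ n ≤ ⌊x⌋} k(x/n)/n` (real-valued). [cite: BaezDuarte2005Moebius, §4 Prop. 4.3 (test function for the hypothesis-free statement)] -/
def phi0R (x : ℝ) : ℝ :=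
  ∑ n ∈ Finset.Icc 1 ⌊x⌋₊, kern (x / n) / n

/-- `φ₀` as a complex-valued test function for `G`. [cite: BaezDuarte2005Moebius, §4 Prop. 4.3 (test function)] -/
def phi0 (x : ℝ) : ℂ := ((phi0R x : ℝ) : ℂ)

/-- `H_n = Σ_{1 ≤ i ≤ n} 1/i` over `ℝ` (Mathlib's `harmonic`, cast). [folklore] -/
def harmR (n : ℕ) : ℝ := ∑ i ∈ Finset.Icc 1 n, (i : ℝ)⁻¹

/-- `k` is measurable. [folklore] -/
private theorem measurable_kern : Measurable kern :=
  (measurable_const.indicator measurableSet_Ico).sub (measurable_const.indicator measurableSet_Ico)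

/-- `|k| ≤ 1`. [folklore] -/
private theorem abs_kern_le_one (v : ℝ) : |kern v| ≤ 1 := by
  unfold kern
  by_cases h1 : v ∈ Set.Ico (1 : ℝ) 2 <;> by_cases h2 : v ∈ Set.Ico (2 : ℝ) 4 <;>
    simp only [Set.indicator_of_mem, Set.indicator_of_notMem, h1, h2, not_false_eq_true] <;>
    norm_num

/-- `k(v) = 0` for `v < 1`. [folklore] -/
private theorem kern_of_lt_one {v : ℝ} (hv : v < 1) : kern v = 0 := by
  unfold kern
  rw [Set.indicator_of_notMem, Set.indicator_of_notMem, sub_zero]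
  · exact fun h ↦ by linarith [h.1]
  · exact fun h ↦ by linarith [h.1]

/-- `k(v) = 0` for `v ≥ 4`. [folklore] -/
private theorem kern_of_four_le {v : ℝ} (hv : 4 ≤ v) : kern v = 0 := by
  unfold kern
  rw [Set.indicator_of_notMem, Set.indicator_of_notMem, sub_zero]
  · exact fun h ↦ by linarith [h.2]
  · exact fun h ↦ by linarith [h.2]

/-- `k(v) = 1` on `[1,2)`. [folklore] -/
private theorem kern_of_mem_Ico_one {v : ℝ} (hv : v ∈ Set.Ico (1 : ℝ) 2) : kern v = 1 := by
  unfold kern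
  rw [Set.indicator_of_mem hv, Set.indicator_of_notMem, sub_zero]
  exact fun h ↦ by linarith [h.1, hv.2]

/-- `k(v) = −1` on `[2,4)`. [folklore] -/
private theorem kern_of_mem_Ico_two {v : ℝ} (hv : v ∈ Set.Ico (2 : ℝ) 4) : kern v = -1 := by
  unfold kern
  rw [Set.indicator_of_notMem, Set.indicator_of_mem hv, zero_sub]
  exact fun h ↦ by linarith [h.2, hv.1]

/-- `φ₀(x) = 0` for `x < 1` (empty sum). [folklore] -/
private theorem phi0R_of_lt_one {x : ℝ} (hx : x < 1) : phi0R x = 0 := by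
  unfold phi0R
  rcases lt_or_ge x 0 with h | h
  · rw [Nat.floor_of_nonpos h.le]; simp
  · rw [Nat.floor_eq_zero.2 hx]; simp

/-- Extending the range of summation: for `⌊x⌋ ≤ N`,
`φ₀(x) = Σ_{1 ≤ n ≤ N} k(x/n)/n` (the added terms have `x/n < 1`). [folklore] -/
private theorem phi0R_eq_sum_of_le {x : ℝ} {N : ℕ} (hN : ⌊x⌋₊ ≤ N) :
    phi0R x = ∑ n ∈ Finset.Icc 1 N, kern (x / n) / n := by
  unfold phi0R
  refine Finset.sum_subset (Finset.Icc_subset_Icc_right hN) fun n hn hn' ↦ ?_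
  have hn1 : 1 ≤ n := (Finset.mem_Icc.1 hn).1
  have hnx : ⌊x⌋₊ < n := by
    by_contra h
    exact hn' (Finset.mem_Icc.2 ⟨hn1, not_lt.1 h⟩)
  have hxn : x < n := Nat.lt_of_floor_lt hnx
  have hn0 : (0 : ℝ) < n := by exact_mod_cast hn1
  rw [kern_of_lt_one ((div_lt_one hn0).2 hxn), zero_div]

/-- The trivial bound `|φ₀(x)| ≤ ⌊x⌋`. [folklore] -/
private theorem abs_phi0R_le_floor (x : ℝ) : |phi0R x| ≤ ⌊x⌋₊ := by
  unfold phi0R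
  refine (Finset.abs_sum_le_sum_abs _ _).trans ?_
  calc ∑ n ∈ Finset.Icc 1 ⌊x⌋₊, |kern (x / n) / n| ≤ ∑ n ∈ Finset.Icc 1 ⌊x⌋₊, (1 : ℝ) := by
        refine Finset.sum_le_sum fun n hn ↦ ?_
        have hn1 : (1 : ℝ) ≤ n := by exact_mod_cast (Finset.mem_Icc.1 hn).1
        rw [abs_div, abs_of_pos (by linarith : (0 : ℝ) < n)]
        exact (div_le_one (by linarith)).2 ((abs_kern_le_one _).trans hn1)
    _ = ⌊x⌋₊ := by simp

/-! ## §2 The block structure: `Σ_{n ≤ N} 𝟙_{[a,2a)}(x/n)/n = H_{⌊x/a⌋} − H_{⌊x/(2a)⌋}` -/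

/-- `Σ_{b < n ≤ c} 1/n = H_c − H_b` for `b ≤ c`. [folklore] -/
private theorem sum_Ioc_inv_eq (b c : ℕ) (hbc : b ≤ c) :
    ∑ n ∈ Finset.Ioc b c, (n : ℝ)⁻¹ = harmR c - harmR b := by
  unfold harmR
  rw [show Finset.Icc 1 c = Finset.Ioc 0 c from rfl, show Finset.Icc 1 b = Finset.Ioc 0 b from rfl,
    ← Finset.sum_Ioc_consecutive _ (Nat.zero_le b) hbc]
  ring

/-- For `0 ≤ x`, `1 ≤ a` and `⌊x⌋ ≤ N`: `Σ_{1 ≤ n ≤ N} 𝟙_{[a,2a)}(x/n)/n = H_{⌊x/a⌋} − H_{⌊x/(2a)⌋}`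
(the terms present are exactly `x/(2a) < n ≤ x/a`). [folklore] -/
private theorem sum_indicator_block_eq {x a : ℝ} (hx : 0 ≤ x) (ha : 1 ≤ a) {N : ℕ} (hN : ⌊x⌋₊ ≤ N) :
    ∑ n ∈ Finset.Icc 1 N, (Set.Ico a (2 * a)).indicator (fun _ ↦ (1 : ℝ)) (x / n) / n =
      harmR ⌊x / a⌋₊ - harmR ⌊x / (2 * a)⌋₊ := by
  have ha0 : 0 < a := by linarith
  have hxa : 0 ≤ x / a := div_nonneg hx ha0.le
  have hx2a : 0 ≤ x / (2 * a) := div_nonneg hx (by linarith)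
  have hbc : ⌊x / (2 * a)⌋₊ ≤ ⌊x / a⌋₊ :=
    Nat.floor_le_floor (div_le_div_of_nonneg_left hx ha0 (by linarith))
  rw [← sum_Ioc_inv_eq _ _ hbc]
  -- rewrite the indicator sum as a sum over the filter, then identify the filter
  have hfilter : ∀ n ∈ Finset.Icc 1 N,
      (Set.Ico a (2 * a)).indicator (fun _ ↦ (1 : ℝ)) (x / n) / n =
        if n ∈ Finset.Ioc ⌊x / (2 * a)⌋₊ ⌊x / a⌋₊ then (n : ℝ)⁻¹ else 0 := by
    intro n hn
    have hn1 : 1 ≤ n := (Finset.mem_Icc.1 hn).1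
    have hn0 : (0 : ℝ) < n := by exact_mod_cast hn1
    have hiff : x / n ∈ Set.Ico a (2 * a) ↔ n ∈ Finset.Ioc ⌊x / (2 * a)⌋₊ ⌊x / a⌋₊ := by
      rw [Set.mem_Ico, Finset.mem_Ioc, Nat.floor_lt hx2a, Nat.le_floor_iff hxa,
        le_div_iff₀ hn0, div_lt_iff₀ hn0, div_lt_iff₀ (by linarith : (0 : ℝ) < 2 * a),
        le_div_iff₀ ha0]
      constructor
      · rintro ⟨h1, h2⟩; constructor <;> linarith
      · rintro ⟨h1, h2⟩; constructor <;> linarith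
    by_cases h : x / n ∈ Set.Ico a (2 * a)
    · rw [Set.indicator_of_mem h, if_pos (hiff.1 h), one_div]
    · rw [Set.indicator_of_notMem h, if_neg (fun h' ↦ h (hiff.2 h')), zero_div]
  rw [Finset.sum_congr rfl hfilter, ← Finset.sum_filter]
  congr 1
  ext n
  simp only [Finset.mem_filter, Finset.mem_Icc, Finset.mem_Ioc]
  constructor
  · rintro ⟨-, h⟩; exact h
  · rintro ⟨h1, h2⟩
    refine ⟨⟨by omega, h2.trans ?_⟩, h1, h2⟩
    exact (Nat.floor_le_floor (div_le_self hx ha)).trans hN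

/-- **`φ₀` in harmonic form**: `φ₀(x) = H_{⌊x⌋} − 2H_{⌊x/2⌋} + H_{⌊x/4⌋}`. [folklore] -/
private theorem phi0R_eq_harmR (x : ℝ) :
    phi0R x = harmR ⌊x⌋₊ - 2 * harmR ⌊x / 2⌋₊ + harmR ⌊x / 4⌋₊ := by
  rcases lt_or_ge x 0 with hx | hx
  · rw [phi0R_of_lt_one (by linarith), Nat.floor_of_nonpos hx.le,
      Nat.floor_of_nonpos (by linarith : x / 2 ≤ 0), Nat.floor_of_nonpos (by linarith : x / 4 ≤ 0)]
    simp [harmR]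
  have h1 := sum_indicator_block_eq hx le_rfl (le_refl ⌊x⌋₊)
  have h2 := sum_indicator_block_eq hx (by norm_num : (1 : ℝ) ≤ 2) (le_refl ⌊x⌋₊)
  rw [mul_one, div_one] at h1
  rw [show (2 : ℝ) * 2 = 4 by norm_num] at h2
  unfold phi0R kern
  simp_rw [sub_div, Finset.sum_sub_distrib]
  rw [h1, h2]
  ring

/-- `φ₀` is measurable (harmonic form: compositions with `⌊·⌋`). [folklore] -/
private theorem measurable_phi0R : Measurable phi0R := by
  have h : phi0R = fun x ↦ harmR ⌊x⌋₊ - 2 * harmR ⌊x / 2⌋₊ + harmR ⌊x / 4⌋₊ :=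
    funext phi0R_eq_harmR
  rw [h]
  have hf : ∀ c : ℝ, Measurable fun x : ℝ ↦ harmR ⌊x / c⌋₊ := fun c ↦
    (measurable_from_nat (f := harmR)).comp (Nat.measurable_floor.comp (measurable_id.div_const c))
  have h1 : Measurable fun x : ℝ ↦ harmR ⌊x⌋₊ :=
    (measurable_from_nat (f := harmR)).comp Nat.measurable_floor
  exact (h1.sub ((hf 2).const_mul 2)).add (hf 4)

/-! ## §3 The Möbius unfolding identity `Σ_{n ≤ y} g(y/n)/n = 1` (`y ≥ 1`) -/

/-- The arithmetic function `n ↦ 1/n`. [folklore] -/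
def invAF : ArithmeticFunction ℝ := ⟨fun n ↦ (n : ℝ)⁻¹, by simp⟩

/-- The arithmetic function `n ↦ μ(n)/n`. [folklore] -/
def moebiusDivAF : ArithmeticFunction ℝ := ⟨fun n ↦ ((μ n : ℤ) : ℝ) / n, by simp⟩

/-- `(1/· ⋆ μ/·)(k) = [k = 1]` (Möbius inversion `Σ_{d | k} μ(d) = [k = 1]`, divided by `k`).
[folklore] -/
private theorem invAF_mul_moebiusDivAF_apply (k : ℕ) :
    (invAF * moebiusDivAF) k = if k = 1 then 1 else 0 := by
  rcases eq_or_ne k 0 with rfl | hk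
  · simp
  rw [ArithmeticFunction.mul_apply]
  have hterm : ∀ i ∈ k.divisorsAntidiagonal,
      invAF i.1 * moebiusDivAF i.2 = (k : ℝ)⁻¹ * ((μ i.2 : ℤ) : ℝ) := by
    intro i hi
    have hprod : i.1 * i.2 = k := (Nat.mem_divisorsAntidiagonal.1 hi).1
    have h1 : (i.1 : ℝ) ≠ 0 := by
      have : i.1 ≠ 0 := fun h ↦ hk (by rw [← hprod, h, zero_mul])
      exact_mod_cast this
    have h2 : (i.2 : ℝ) ≠ 0 := by
      have : i.2 ≠ 0 := fun h ↦ hk (by rw [← hprod, h, mul_zero])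
      exact_mod_cast this
    simp only [invAF, moebiusDivAF, ArithmeticFunction.coe_mk]
    rw [← hprod, Nat.cast_mul]
    field_simp
  rw [Finset.sum_congr rfl hterm, ← Finset.mul_sum,
    Nat.sum_divisorsAntidiagonal' (fun _ b ↦ ((μ b : ℤ) : ℝ))]
  have hμ : ∑ d ∈ k.divisors, ((μ d : ℤ) : ℝ) = if k = 1 then 1 else 0 := by
    have h := congrArg (fun f : ArithmeticFunction ℤ ↦ (f k : ℝ)) ArithmeticFunction.moebius_mul_coe_zeta
    simp only [ArithmeticFunction.coe_mul_zeta_apply, ArithmeticFunction.one_apply] at h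
    push_cast at h
    rw [h]
  rw [hμ]
  split_ifs with h1
  · subst h1; simp
  · simp

/-- `g(y/n) = Σ_{m ≤ ⌊y⌋/n} μ(m)/m` for `n ≥ 1`: `⌊y/n⌋ = ⌊y⌋/n`. [folklore] -/
private theorem moebiusDivSum_div_natCast (y : ℝ) (n : ℕ) :
    moebiusDivSum (y / n) = ∑ m ∈ Finset.Ioc 0 (⌊y⌋₊ / n), moebiusDivAF m := by
  unfold moebiusDivSum
  rw [Nat.floor_div_natCast, show Finset.Icc 1 (⌊y⌋₊ / n) = Finset.Ioc 0 (⌊y⌋₊ / n) from rfl]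
  rfl

/-- **Möbius unfolding**: `Σ_{1 ≤ n ≤ ⌊y⌋} g(y/n)/n = 1` for `y ≥ 1` (and `= 0` for `0 ≤ y < 1`,
the sum being empty), where `g(x) = Σ_{m ≤ x} μ(m)/m`: the double sum is
`Σ_{k ≤ y} (1/k) Σ_{d | k} μ(d) = 1` — the finite (Dirichlet-hyperbola) form of Báez-Duarte's
(2.12) `ζ(s+1) · s g^∧(s) = 1`. [cite: BaezDuarte2005Moebius, §2 eq. (2.12) (Möbius inversion, finite form)] -/
theorem sum_moebiusDivSum_div_eq_one {y : ℝ} (hy : 1 ≤ y) :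
    ∑ n ∈ Finset.Icc 1 ⌊y⌋₊, moebiusDivSum (y / n) / n = 1 := by
  have hN : 1 ≤ ⌊y⌋₊ := Nat.le_floor (by simpa using hy)
  have h := ArithmeticFunction.sum_Ioc_mul_eq_sum_sum invAF moebiusDivAF ⌊y⌋₊
  simp_rw [invAF_mul_moebiusDivAF_apply, Finset.sum_ite_eq', Finset.mem_Ioc] at h
  rw [if_pos ⟨Nat.zero_lt_one, hN⟩] at h
  rw [show Finset.Icc 1 ⌊y⌋₊ = Finset.Ioc 0 ⌊y⌋₊ from rfl, h]
  refine Finset.sum_congr rfl fun n _ ↦ ?_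
  rw [moebiusDivSum_div_natCast, div_eq_inv_mul]
  rfl

/-! ## §4 `Gφ₀(x) = ∫₀^∞ 𝟙[v ≤ x] k(v) dv/v` (Möbius unfolding); `Gφ₀ = 0` on `[4, ∞)` -/

open BaezDuarteMellin (measurable_moebiusDivSum exists_abs_moebiusDivSum_le)

/-- The substitution `t = 1/u` in `G` (real form): `∫₀^∞ g(xt) r(1/t) dt/t = ∫₀^∞ g(x/u) r(u) du/u`
(no integrability needed). [cite: BaezDuarte2005Moebius, §3.1 eq. (3.1) (the substitution t ↦ 1/t)] -/
theorem integral_moebiusDivSum_mul_comp_inv (r : ℝ → ℝ) (x : ℝ) :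
    ∫ t in Ioi (0 : ℝ), moebiusDivSum (x * t) * r (1 / t) / t =
      ∫ u in Ioi (0 : ℝ), moebiusDivSum (x / u) * r u / u := by
  rw [← integral_comp_rpow_Ioi (fun u : ℝ ↦ moebiusDivSum (x / u) * r u / u)
    (by norm_num : (-1 : ℝ) ≠ 0)]
  refine setIntegral_congr_fun measurableSet_Ioi fun t ht ↦ ?_
  have ht0 : (0 : ℝ) < t := ht
  simp only [abs_neg, abs_one, one_mul, smul_eq_mul]
  rw [show (-1 : ℝ) - 1 = -2 by norm_num, Real.rpow_neg_one, Real.rpow_neg ht0.le, Real.rpow_two,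
    div_inv_eq_mul, one_div]
  field_simp

/-- `Gφ₀(x)` in real `u`-form: `Gφ₀(x) = ∫₀^∞ g(x/u) φ₀(u) du/u`. [cite: BaezDuarte2005Moebius, §3.1 eq. (3.1)] -/
theorem moebiusConv_phi0_eq_integral (x : ℝ) :
    moebiusConv phi0 x = ((∫ u in Ioi (0 : ℝ), moebiusDivSum (x / u) * phi0R u / u : ℝ) : ℂ) := by
  unfold moebiusConv phi0
  rw [← integral_moebiusDivSum_mul_comp_inv, ← integral_complex_ofReal]
  refine setIntegral_congr_fun measurableSet_Ioi fun t _ ↦ ?_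
  push_cast
  ring

/-- Pointwise unfolding of the integrand: for `0 ≤ x` and `u > 0`,
`g(x/u) φ₀(u)/u = Σ_{1 ≤ n ≤ ⌊x⌋} g(x/u) k(u/n)/(n u)` (for `u > x` both sides vanish, for `u ≤ x`
the summation range of `φ₀(u)` may be extended to `⌊x⌋`). [folklore] -/
private theorem integrand_eq_sum {x u : ℝ} (hu : 0 < u) :
    moebiusDivSum (x / u) * phi0R u / u =
      ∑ n ∈ Finset.Icc 1 ⌊x⌋₊, moebiusDivSum (x / u) * (kern (u / n) / n) / u := by
  rcases lt_or_ge x u with hxu | hxu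
  · rw [moebiusDivSum_of_lt_one ((div_lt_one hu).2 hxu)]
    simp
  · rw [phi0R_eq_sum_of_le (Nat.floor_le_floor hxu), Finset.mul_sum, Finset.sum_div]

/-- A bounded measurable function vanishing off `[a, b]` is integrable on `(0, ∞)`. [folklore] -/
private theorem integrableOn_Ioi_of_bdd_support {f : ℝ → ℝ} (hf : Measurable f) {a b M : ℝ}
    (hsupp : ∀ u, 0 < u → (u < a ∨ b < u) → f u = 0) (hM : ∀ u, |f u| ≤ M) :
    IntegrableOn f (Ioi 0) := by
  have h1 : IntegrableOn f (Icc a b) :=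
    Integrable.mono' (integrableOn_const (C := M) (hs := measure_Icc_lt_top.ne)) hf.aestronglyMeasurable
      (ae_of_all _ fun u ↦ by rw [Real.norm_eq_abs]; exact hM u)
  have h2 : IntegrableOn f (Ioi 0 \ Icc a b) := by
    refine (integrableOn_zero (s := Ioi 0 \ Icc a b)).congr_fun (fun u hu ↦ ?_)
      (measurableSet_Ioi.diff measurableSet_Icc)
    have hu0 : 0 < u := hu.1
    have : u < a ∨ b < u := by
      by_contra h
      push Not at h
      exact hu.2 ⟨h.1, h.2⟩
    exact (hsupp u hu0 this).symm
  exact (h1.union h2).mono_set (fun u hu ↦ by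
    by_cases h : u ∈ Icc a b
    · exact Or.inl h
    · exact Or.inr ⟨hu, h⟩)

/-- The `u`-terms are integrable: `u ↦ g(x/u) k(u/n)/(n u)` is bounded by `sup|g|` and supported in
`[n, 4n]`. [folklore] -/
private theorem integrableOn_term_u (x : ℝ) {n : ℕ} (hn : 1 ≤ n) :
    IntegrableOn (fun u : ℝ ↦ moebiusDivSum (x / u) * (kern (u / n) / n) / u) (Ioi 0) := by
  obtain ⟨B, hB, hgB⟩ := exists_abs_moebiusDivSum_le
  have hn0 : (0 : ℝ) < n := by exact_mod_cast hn
  have hn1 : (1 : ℝ) ≤ n := by exact_mod_cast hn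
  refine integrableOn_Ioi_of_bdd_support (a := n) (b := 4 * n) (M := B) ?_ ?_ ?_
  · exact ((measurable_moebiusDivSum.comp (measurable_const.div measurable_id)).mul
      ((measurable_kern.comp (measurable_id.div_const _)).div_const _)).div measurable_id
  · intro u hu0 hu
    rcases hu with hu | hu
    · rw [kern_of_lt_one ((div_lt_one hn0).2 hu)]; simp
    · rw [kern_of_four_le ((le_div_iff₀ hn0).2 (by linarith))]; simp
  · intro u
    by_cases hk : kern (u / n) = 0
    · rw [hk]; simp; exact hB.le
    · have hu1 : 1 ≤ u / n := by
        by_contra h; exact hk (kern_of_lt_one (not_le.1 h))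
      have hun : (n : ℝ) ≤ u := by rwa [le_div_iff₀ hn0, one_mul] at hu1
      have hu0 : 0 < u := lt_of_lt_of_le hn0 hun
      rw [abs_div, abs_mul, abs_div, abs_of_pos hn0, abs_of_pos hu0]
      calc |moebiusDivSum (x / u)| * (|kern (u / n)| / n) / u ≤ B * (1 / 1) / 1 := by
            gcongr
            · exact hgB _
            · exact abs_kern_le_one _
            · linarith
        _ = B := by ring

/-- The `v`-terms are integrable: `v ↦ g(x/(nv)) k(v)/(n v)` is bounded by `sup|g|` and supported in
`[1, 4]`. [folklore] -/
private theorem integrableOn_term_v (x : ℝ) {n : ℕ} (hn : 1 ≤ n) :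
    IntegrableOn (fun v : ℝ ↦ moebiusDivSum (x / (n * v)) * (kern v / n) / v) (Ioi 0) := by
  obtain ⟨B, hB, hgB⟩ := exists_abs_moebiusDivSum_le
  have hn0 : (0 : ℝ) < n := by exact_mod_cast hn
  have hn1 : (1 : ℝ) ≤ n := by exact_mod_cast hn
  refine integrableOn_Ioi_of_bdd_support (a := 1) (b := 4) (M := B) ?_ ?_ ?_
  · exact ((measurable_moebiusDivSum.comp (measurable_const.div (measurable_id.const_mul _))).mul
      (measurable_kern.div_const _)).div measurable_id
  · intro v hv0 hv
    rcases hv with hv | hv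
    · rw [kern_of_lt_one hv]; simp
    · rw [kern_of_four_le hv.le]; simp
  · intro v
    by_cases hk : kern v = 0
    · rw [hk]; simp; exact hB.le
    · have hv1 : 1 ≤ v := by
        by_contra h; exact hk (kern_of_lt_one (not_le.1 h))
      have hv0 : 0 < v := by linarith
      rw [abs_div, abs_mul, abs_div, abs_of_pos hn0, abs_of_pos hv0]
      calc |moebiusDivSum (x / (n * v))| * (|kern v| / n) / v ≤ B * (1 / 1) / 1 := by
            gcongr
            · exact hgB _
            · exact abs_kern_le_one _
        _ = B := by ring

/-- The substitution `u = n v` in the `n`-th term: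
`∫₀^∞ g(x/u) k(u/n)/(n u) du = ∫₀^∞ g(x/(nv)) k(v)/(n v) dv`. [folklore] -/
private theorem integral_term_u_eq (x : ℝ) {n : ℕ} (hn : 1 ≤ n) :
    ∫ u in Ioi (0 : ℝ), moebiusDivSum (x / u) * (kern (u / n) / n) / u =
      ∫ v in Ioi (0 : ℝ), moebiusDivSum (x / (n * v)) * (kern v / n) / v := by
  have hn0 : (0 : ℝ) < n := by exact_mod_cast hn
  have h := integral_comp_mul_left_Ioi (fun u : ℝ ↦ moebiusDivSum (x / u) * (kern (u / n) / n) / u)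
    0 hn0
  rw [mul_zero] at h
  -- `h : ∫ v, F(n v) = n⁻¹ • ∫ u, F u`
  have hF : ∀ v : ℝ, (fun u : ℝ ↦ moebiusDivSum (x / u) * (kern (u / n) / n) / u) ((n : ℝ) * v) =
      (n : ℝ)⁻¹ * (moebiusDivSum (x / (n * v)) * (kern v / n) / v) := by
    intro v
    simp only [mul_div_cancel_left₀ v hn0.ne']
    field_simp
  simp_rw [hF, integral_const_mul, smul_eq_mul] at h
  exact (mul_right_injective₀ (inv_ne_zero hn0.ne') h).symm

/-- The integrand left after unfolding: `𝟙[v ≤ x] k(v)/v`. [folklore] -/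
def tentIntegrand (x v : ℝ) : ℝ := if v ≤ x then kern v / v else 0

/-- Pointwise evaluation of the unfolded sum: for `0 ≤ x` and `v > 0`,
`Σ_{1 ≤ n ≤ ⌊x⌋} g(x/(nv)) k(v)/(n v) = 𝟙[v ≤ x] k(v)/v` (Möbius unfolding at `y = x/v`).
[folklore] -/
private theorem sum_term_v_eq {x v : ℝ} (hx : 0 ≤ x) (hv : 0 < v) :
    ∑ n ∈ Finset.Icc 1 ⌊x⌋₊, moebiusDivSum (x / (n * v)) * (kern v / n) / v = tentIntegrand x v := by
  unfold tentIntegrand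
  by_cases hk : kern v = 0
  · rw [hk]; simp
  have hv1 : 1 ≤ v := by
    by_contra h; exact hk (kern_of_lt_one (not_le.1 h))
  have hterm : ∀ n ∈ Finset.Icc 1 ⌊x⌋₊, moebiusDivSum (x / (n * v)) * (kern v / n) / v =
      (moebiusDivSum ((x / v) / n) / n) * (kern v / v) := by
    intro n hn
    have hn0 : (0 : ℝ) < n := by exact_mod_cast (Finset.mem_Icc.1 hn).1
    rw [div_div, mul_comm v]
    field_simp
  rw [Finset.sum_congr rfl hterm, ← Finset.sum_mul]
  -- reduce the range `⌊x⌋` to `⌊x/v⌋`: the extra terms vanish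
  have hxv : x / v ≤ x := div_le_self hx hv1
  have hsum : ∑ n ∈ Finset.Icc 1 ⌊x⌋₊, moebiusDivSum ((x / v) / n) / n =
      ∑ n ∈ Finset.Icc 1 ⌊x / v⌋₊, moebiusDivSum ((x / v) / n) / n := by
    symm
    refine Finset.sum_subset (Finset.Icc_subset_Icc_right (Nat.floor_le_floor hxv))
      fun n hn hn' ↦ ?_
    have hn1 : 1 ≤ n := (Finset.mem_Icc.1 hn).1
    have hn0 : (0 : ℝ) < n := by exact_mod_cast hn1
    have hlt : ⌊x / v⌋₊ < n := by
      by_contra h; exact hn' (Finset.mem_Icc.2 ⟨hn1, not_lt.1 h⟩)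
    rw [moebiusDivSum_of_lt_one ((div_lt_one hn0).2 (Nat.lt_of_floor_lt hlt)), zero_div]
  rw [hsum]
  split_ifs with hvx
  · rw [sum_moebiusDivSum_div_eq_one ((one_le_div hv).2 hvx), one_mul]
  · have hlt : x / v < 1 := (div_lt_one hv).2 (not_le.1 hvx)
    rw [Nat.floor_eq_zero.2 hlt]
    simp

/-- **Möbius unfolding of `Gφ₀`**: for `x ≥ 0`, `Gφ₀(x) = ∫₀^∞ 𝟙[v ≤ x] k(v) dv/v`. RH-FREE.
[cite: BaezDuarte2005Moebius, §3.1 eq. (3.1) and §2 eq. (2.12) (`Σ μ(n)/n`-unfolding)] -/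
theorem moebiusConv_phi0_eq (x : ℝ) (hx : 0 ≤ x) :
    moebiusConv phi0 x = ((∫ v in Ioi (0 : ℝ), tentIntegrand x v : ℝ) : ℂ) := by
  rw [moebiusConv_phi0_eq_integral]
  congr 1
  calc ∫ u in Ioi (0 : ℝ), moebiusDivSum (x / u) * phi0R u / u
      = ∫ u in Ioi (0 : ℝ), ∑ n ∈ Finset.Icc 1 ⌊x⌋₊, moebiusDivSum (x / u) * (kern (u / n) / n) / u :=
        setIntegral_congr_fun measurableSet_Ioi fun u hu ↦ integrand_eq_sum hu
    _ = ∑ n ∈ Finset.Icc 1 ⌊x⌋₊, ∫ u in Ioi (0 : ℝ), moebiusDivSum (x / u) * (kern (u / n) / n) / u :=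
        integral_finsetSum _ fun n hn ↦ integrableOn_term_u x (Finset.mem_Icc.1 hn).1
    _ = ∑ n ∈ Finset.Icc 1 ⌊x⌋₊, ∫ v in Ioi (0 : ℝ), moebiusDivSum (x / (n * v)) * (kern v / n) / v :=
        Finset.sum_congr rfl fun n hn ↦ integral_term_u_eq x (Finset.mem_Icc.1 hn).1
    _ = ∫ v in Ioi (0 : ℝ), ∑ n ∈ Finset.Icc 1 ⌊x⌋₊, moebiusDivSum (x / (n * v)) * (kern v / n) / v :=
        (integral_finsetSum _ fun n hn ↦ integrableOn_term_v x (Finset.mem_Icc.1 hn).1).symm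
    _ = ∫ v in Ioi (0 : ℝ), tentIntegrand x v :=
        setIntegral_congr_fun measurableSet_Ioi fun v hv ↦ sum_term_v_eq hx hv

/-- `∫₀^∞ k(v) dv/v = log 2 − log 2 = 0`, in the form: for `x ≥ 4`, `∫₀^∞ 𝟙[v ≤ x] k(v) dv/v = 0`.
[folklore] -/
private theorem integral_tentIntegrand_eq_zero {x : ℝ} (hx : 4 ≤ x) :
    ∫ v in Ioi (0 : ℝ), tentIntegrand x v = 0 := by
  have hpt : ∀ v ∈ Ioi (0 : ℝ), tentIntegrand x v =
      (Set.Ico (1 : ℝ) 2).indicator (fun v ↦ v⁻¹) v - (Set.Ico (2 : ℝ) 4).indicator (fun v ↦ v⁻¹) v := by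
    intro v _
    unfold tentIntegrand
    by_cases hv4 : v < 4
    · rw [if_pos (by linarith)]
      unfold kern
      by_cases h1 : v ∈ Set.Ico (1 : ℝ) 2 <;> by_cases h2 : v ∈ Set.Ico (2 : ℝ) 4 <;>
        simp only [Set.indicator_of_mem, Set.indicator_of_notMem, h1, h2, not_false_eq_true] <;>
        ring
    · rw [kern_of_four_le (not_lt.1 hv4), zero_div, Set.indicator_of_notMem, Set.indicator_of_notMem]
      · simp
      · exact fun h ↦ hv4 h.2
      · exact fun h ↦ hv4 (by linarith [h.2])
  rw [setIntegral_congr_fun measurableSet_Ioi hpt]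
  have hI : ∀ a b : ℝ, 0 < a → a ≤ b →
      ∫ v in Ioi (0 : ℝ), (Set.Ico a b).indicator (fun v ↦ v⁻¹) v = Real.log (b / a) := by
    intro a b ha hab
    rw [integral_indicator measurableSet_Ico, Measure.restrict_restrict measurableSet_Ico,
      show Set.Ico a b ∩ Ioi 0 = Set.Ico a b from
        Set.inter_eq_left.2 fun v hv ↦ lt_of_lt_of_le ha hv.1,
      integral_Ico_eq_integral_Ioo, ← integral_Ioc_eq_integral_Ioo,
      ← intervalIntegral.integral_of_le hab]
    exact integral_inv (Set.notMem_uIcc_of_lt ha (lt_of_lt_of_le ha hab))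
  have hint1 : IntegrableOn (fun v : ℝ ↦ (Set.Ico (1 : ℝ) 2).indicator (fun v ↦ v⁻¹) v) (Ioi 0) := by
    refine integrableOn_Ioi_of_bdd_support (a := 1) (b := 2) (M := 1)
      (measurable_inv.indicator measurableSet_Ico) (fun v _ hv ↦ ?_) (fun v ↦ ?_)
    · exact Set.indicator_of_notMem (fun h ↦ by rcases hv with hv | hv <;> linarith [h.1, h.2]) _
    · by_cases h : v ∈ Set.Ico (1 : ℝ) 2
      · rw [Set.indicator_of_mem h, abs_of_pos (inv_pos.2 (by linarith [h.1]))]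
        exact inv_le_one_of_one_le₀ h.1
      · rw [Set.indicator_of_notMem h]; simp
  have hint2 : IntegrableOn (fun v : ℝ ↦ (Set.Ico (2 : ℝ) 4).indicator (fun v ↦ v⁻¹) v) (Ioi 0) := by
    refine integrableOn_Ioi_of_bdd_support (a := 2) (b := 4) (M := 1)
      (measurable_inv.indicator measurableSet_Ico) (fun v _ hv ↦ ?_) (fun v ↦ ?_)
    · exact Set.indicator_of_notMem (fun h ↦ by rcases hv with hv | hv <;> linarith [h.1, h.2]) _
    · by_cases h : v ∈ Set.Ico (2 : ℝ) 4
      · rw [Set.indicator_of_mem h, abs_of_pos (inv_pos.2 (by linarith [h.1]))]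
        exact inv_le_one_of_one_le₀ (by linarith [h.1])
      · rw [Set.indicator_of_notMem h]; simp
  rw [integral_sub hint1 hint2, hI 1 2 one_pos (by norm_num), hI 2 4 two_pos (by norm_num)]
  norm_num

/-- **`Gφ₀(x) = 0` for every `x ≥ 4`** (RH-FREE). [cite: BaezDuarte2005Moebius, §4 Prop. 4.3 (the witness against the hypothesis-free statement)] -/
theorem moebiusConv_phi0_eq_zero {x : ℝ} (hx : 4 ≤ x) : moebiusConv phi0 x = 0 := by
  rw [moebiusConv_phi0_eq x (by linarith), integral_tentIntegrand_eq_zero hx]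
  simp

/-- Hence `Gφ₀ = o(x^{−1/2})` (indeed `Gφ₀` vanishes identically near `+∞`). [cite: BaezDuarte2005Moebius, §4 Prop. 4.3] -/
theorem moebiusConv_phi0_isLittleO :
    moebiusConv phi0 =o[atTop] fun x : ℝ ↦ x ^ (-(1 / 2 : ℝ)) := by
  refine Asymptotics.IsLittleO.of_bound fun c hc ↦ ?_
  filter_upwards [eventually_ge_atTop (4 : ℝ)] with x hx
  rw [moebiusConv_phi0_eq_zero hx, norm_zero]
  positivity

/-! ## §5 `φ₀` is proper: `|φ₀(x)| ≤ 64/x` (Euler–Mascheroni bounds for the harmonic numbers) -/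

/-- `harmR n = harmonic n`. [folklore] -/
private theorem harmR_eq_harmonic (n : ℕ) : harmR n = (harmonic n : ℝ) := by
  rw [harmR, harmonic_eq_sum_Icc]
  push_cast
  rfl

/-- `log n + γ < H_n` for `n ≥ 1`. [folklore] -/
private theorem log_add_lt_harmR {n : ℕ} (hn : 1 ≤ n) :
    Real.log n + Real.eulerMascheroniConstant < harmR n := by
  have h := Real.eulerMascheroniConstant_lt_eulerMascheroniSeq' n
  rw [Real.eulerMascheroniSeq', if_neg (by omega)] at h
  rw [harmR_eq_harmonic]
  linarith

/-- `H_n < log (n+1) + γ`. [folklore] -/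
private theorem harmR_lt_log_add (n : ℕ) :
    harmR n < Real.log (n + 1) + Real.eulerMascheroniConstant := by
  have h := Real.eulerMascheroniSeq_lt_eulerMascheroniConstant n
  rw [Real.eulerMascheroniSeq] at h
  rw [harmR_eq_harmonic]
  linarith

/-- The block estimate: for `y ≥ 4`, `|(H_{⌊y⌋} − H_{⌊y/2⌋}) − log 2| ≤ 6/y`. [folklore] -/
private theorem abs_block_sub_log_two_le {y : ℝ} (hy : 4 ≤ y) :
    |harmR ⌊y⌋₊ - harmR ⌊y / 2⌋₊ - Real.log 2| ≤ 6 / y := by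
  set a : ℕ := ⌊y⌋₊ with ha
  set b : ℕ := ⌊y / 2⌋₊ with hb
  have hy0 : 0 < y := by linarith
  have hay : (a : ℝ) ≤ y := Nat.floor_le hy0.le
  have hya : y < a + 1 := Nat.lt_floor_add_one y
  have hby : (b : ℝ) ≤ y / 2 := Nat.floor_le (by linarith)
  have hyb : y / 2 < b + 1 := Nat.lt_floor_add_one (y / 2)
  have ha1 : 1 ≤ a := Nat.le_floor (by simp; linarith)
  have hb1 : 1 ≤ b := Nat.le_floor (by simp; linarith)
  have ha0 : (0 : ℝ) < a := by exact_mod_cast ha1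
  have hb0 : (0 : ℝ) < b := by exact_mod_cast hb1
  have hy2 : 0 < y - 2 := by linarith
  have hy2' : y - 2 ≠ 0 := hy2.ne'
  have hy1 : 0 < y - 1 := by linarith
  have hy1' : y - 1 ≠ 0 := hy1.ne'
  -- upper bound: `H_a − H_b < log(a+1) − log b ≤ log 2 + 3/(y−2) ≤ log 2 + 6/y`
  have hup : harmR a - harmR b - Real.log 2 ≤ 6 / y := by
    have h1 : harmR a - harmR b < Real.log (a + 1) - Real.log b := by
      linarith [harmR_lt_log_add a, log_add_lt_harmR hb1]
    have h2 : Real.log (a + 1) - Real.log b ≤ Real.log 2 + 3 / (y - 2) := by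
      have hq : 0 < y / 2 - 1 := by linarith
      have h3 : Real.log (a + 1) ≤ Real.log (y + 1) := Real.log_le_log (by linarith) (by linarith)
      have h4 : Real.log (y / 2 - 1) ≤ Real.log b := Real.log_le_log hq (by linarith)
      have hq' : y / 2 - 1 ≠ 0 := hq.ne'
      have hu : 0 < (y + 1) / (y - 2) := div_pos (by linarith) hy2
      have h5 : Real.log (y + 1) - Real.log (y / 2 - 1) = Real.log 2 + Real.log ((y + 1) / (y - 2)) := by
        rw [← Real.log_div (by linarith) hq', ← Real.log_mul two_ne_zero hu.ne']
        congr 1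
        field_simp
      have h6 : Real.log ((y + 1) / (y - 2)) ≤ 3 / (y - 2) := by
        refine (Real.log_le_sub_one_of_pos hu).trans (le_of_eq ?_)
        field_simp
        ring
      linarith
    have h7 : 3 / (y - 2) ≤ 6 / y := by
      rw [div_le_div_iff₀ (by linarith) hy0]; nlinarith
    linarith
  -- lower bound: `H_a − H_b > log a − log(b+1) ≥ log 2 − 3/(y−1) ≥ log 2 − 6/y`
  have hlow : -(6 / y) ≤ harmR a - harmR b - Real.log 2 := by
    have h1 : Real.log a - Real.log (b + 1) < harmR a - harmR b := by
      linarith [log_add_lt_harmR ha1, harmR_lt_log_add b]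
    have h2 : Real.log 2 - 3 / (y - 1) ≤ Real.log a - Real.log (b + 1) := by
      have h3 : Real.log (y - 1) ≤ Real.log a := Real.log_le_log (by linarith) (by linarith)
      have h4 : Real.log (b + 1) ≤ Real.log (y / 2 + 1) := Real.log_le_log (by positivity) (by linarith)
      have hp' : y / 2 + 1 ≠ 0 := by positivity
      have hu : 0 < (y + 2) / (y - 1) := div_pos (by linarith) hy1
      have h5 : Real.log (y - 1) - Real.log (y / 2 + 1) = Real.log 2 - Real.log ((y + 2) / (y - 1)) := by
        rw [← Real.log_div hy1' hp', ← Real.log_div two_ne_zero hu.ne']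
        congr 1
        field_simp
      have h6 : Real.log ((y + 2) / (y - 1)) ≤ 3 / (y - 1) := by
        refine (Real.log_le_sub_one_of_pos hu).trans (le_of_eq ?_)
        field_simp
        ring
      linarith
    have h7 : 3 / (y - 1) ≤ 6 / y := by
      rw [div_le_div_iff₀ (by linarith) hy0]; nlinarith
    linarith
  exact abs_le.2 ⟨hlow, hup⟩

/-- `φ₀(x) = S(x) − S(x/2)` with `S(y) = H_{⌊y⌋} − H_{⌊y/2⌋}`. [folklore] -/
private theorem phi0R_eq_block_sub (x : ℝ) :
    phi0R x = (harmR ⌊x⌋₊ - harmR ⌊x / 2⌋₊) - (harmR ⌊x / 2⌋₊ - harmR ⌊x / 2 / 2⌋₊) := by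
  rw [phi0R_eq_harmR, div_div, show (2 : ℝ) * 2 = 4 by norm_num]
  ring

/-- **`|φ₀(x)| ≤ 64/x` for `x ≥ 1`** (for `x ≥ 8` from the block estimate, `18/x`; below `8`
trivially). [folklore] -/
private theorem abs_phi0R_le {x : ℝ} (hx : 1 ≤ x) : |phi0R x| ≤ 64 / x := by
  have hx0 : 0 < x := by linarith
  rcases le_or_gt 8 x with h8 | h8
  · rw [phi0R_eq_block_sub]
    have h1 := abs_block_sub_log_two_le (y := x) (by linarith)
    have h2 := abs_block_sub_log_two_le (y := x / 2) (by linarith)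
    have h3 : |harmR ⌊x⌋₊ - harmR ⌊x / 2⌋₊ - (harmR ⌊x / 2⌋₊ - harmR ⌊x / 2 / 2⌋₊)| ≤
        6 / x + 6 / (x / 2) := by
      have := abs_sub_le (harmR ⌊x⌋₊ - harmR ⌊x / 2⌋₊) (Real.log 2)
        (harmR ⌊x / 2⌋₊ - harmR ⌊x / 2 / 2⌋₊)
      rw [abs_sub_comm (Real.log 2)] at this
      linarith
    refine h3.trans ?_
    rw [div_div_eq_mul_div]
    have : 6 / x + 6 * 2 / x = 18 / x := by ring
    rw [this]
    exact div_le_div_of_nonneg_right (by norm_num) hx0.le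
  · calc |phi0R x| ≤ ⌊x⌋₊ := abs_phi0R_le_floor x
      _ ≤ x := Nat.floor_le hx0.le
      _ ≤ 64 / x := by rw [le_div_iff₀ hx0]; nlinarith

/-- `φ₀` is measurable (complex form). [folklore] -/
private theorem measurable_phi0 : Measurable phi0 :=
  Complex.measurable_ofReal.comp measurable_phi0R

/-- `N_σ(φ₀) < ∞` for every `σ > −1`: the integrand vanishes on `(0,1)` and is `≤ 64 x^{−σ−2}` on
`[1, ∞)`. [cite: BaezDuarte2005Moebius, §2 (proper: N_σ(φ) < ∞)] -/
theorem hasFiniteMellinNorm_phi0 {σ : ℝ} (hσ : -1 < σ) : HasFiniteMellinNorm phi0 σ := by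
  unfold HasFiniteMellinNorm
  have hmeas : Measurable fun x : ℝ ↦ x ^ (-σ - 1) * ‖phi0 x‖ :=
    (measurable_id.pow_const _).mul measurable_phi0.norm
  rw [← Ioo_union_Ici_eq_Ioi zero_lt_one]
  refine IntegrableOn.union ?_ ?_
  · refine (integrableOn_zero (s := Ioo (0 : ℝ) 1)).congr_fun (fun x hx ↦ ?_) measurableSet_Ioo
    rw [phi0, phi0R_of_lt_one hx.2]
    simp
  · rw [integrableOn_Ici_iff_integrableOn_Ioi]
    have hmaj : IntegrableOn (fun x : ℝ ↦ 64 * x ^ (-σ - 2)) (Ioi 1) :=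
      (integrableOn_Ioi_rpow_of_lt (by linarith) zero_lt_one).const_mul _
    refine Integrable.mono' hmaj hmeas.aestronglyMeasurable ?_
    refine ae_restrict_of_forall_mem measurableSet_Ioi fun x hx ↦ ?_
    have hx1 : (1 : ℝ) < x := hx
    have hx0 : 0 < x := by linarith
    rw [Real.norm_eq_abs, abs_mul, abs_of_nonneg (Real.rpow_nonneg hx0.le _), abs_norm, phi0,
      Complex.norm_real, Real.norm_eq_abs]
    calc x ^ (-σ - 1) * |phi0R x| ≤ x ^ (-σ - 1) * (64 / x) :=
          mul_le_mul_of_nonneg_left (abs_phi0R_le hx1.le) (Real.rpow_nonneg hx0.le _)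
      _ = 64 * x ^ (-σ - 2) := by
          rw [show -σ - 2 = (-σ - 1) + (-1) by ring, Real.rpow_add hx0, Real.rpow_neg_one]
          field_simp

/-- **`φ₀` is proper** (measurable, `N_σ(φ₀) < ∞` for `σ ∈ (−1/2, 0]`). RH-FREE.
[cite: BaezDuarte2005Moebius, §2 (definition of proper)] -/
theorem isMoebiusProper_phi0 : IsMoebiusProper phi0 :=
  ⟨measurable_phi0, fun _ hσ _ ↦ hasFiniteMellinNorm_phi0 (by linarith)⟩

/-! ## §6 `(Gφ₀)^∧(s) = (1 − 2^{−s})²/s²` (Fubini on `(0,4] × (0,∞)`), hence `φ₀^∧(s) = (1 − 2^{−s})² ζ(s+1)/s` on the strip -/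

/-- The profile `T(x) = ∫₀^∞ 𝟙[v ≤ x] k(v) dv/v` of `Gφ₀`. [folklore] -/
def tent (x : ℝ) : ℝ := ∫ v in Ioi (0 : ℝ), tentIntegrand x v

/-- `|𝟙[v ≤ x] k(v)/v| ≤ 1` (it vanishes unless `v ≥ 1`). [folklore] -/
private theorem abs_tentIntegrand_le_one (x v : ℝ) : |tentIntegrand x v| ≤ 1 := by
  unfold tentIntegrand
  split_ifs
  · by_cases hk : kern v = 0
    · rw [hk]; simp
    · have hv1 : 1 ≤ v := by by_contra h; exact hk (kern_of_lt_one (not_le.1 h))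
      rw [abs_div, abs_of_pos (by linarith : (0 : ℝ) < v)]
      exact (div_le_one (by linarith)).2 ((abs_kern_le_one v).trans hv1)
  · simp

/-- `𝟙[v ≤ x] k(v)/v = 0` unless `1 ≤ v ≤ 4`. [folklore] -/
private theorem tentIntegrand_eq_zero_of {x v : ℝ} (hv : v < 1 ∨ 4 < v) : tentIntegrand x v = 0 := by
  unfold tentIntegrand
  rcases hv with hv | hv
  · rw [kern_of_lt_one hv]; simp
  · rw [kern_of_four_le hv.le]; simp

/-- `T(x) = 0` for `x < 1` (the integrand vanishes) and for `x ≥ 4` (`∫ k dv/v = 0`). [folklore] -/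
private theorem tent_eq_zero_of {x : ℝ} (hx : x < 1 ∨ 4 ≤ x) : tent x = 0 := by
  rcases hx with hx | hx
  · unfold tent
    refine setIntegral_eq_zero_of_forall_eq_zero fun v _ ↦ ?_
    unfold tentIntegrand
    split_ifs with h
    · rw [kern_of_lt_one (by linarith)]; simp
    · rfl
  · exact integral_tentIntegrand_eq_zero hx

/-- Measurability of `(x, v) ↦ 𝟙[v ≤ x] k(v)/v`. [folklore] -/
private theorem measurable_tentIntegrand_uncurry :
    Measurable fun p : ℝ × ℝ ↦ tentIntegrand p.1 p.2 := by
  unfold tentIntegrand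
  refine Measurable.ite ?_ ((measurable_kern.comp measurable_snd).div measurable_snd) measurable_const
  exact measurableSet_le measurable_snd measurable_fst

/-- The inner `x`-integral: for `0 < v`,
`∫_{(0,4]} x^{−s−1} 𝟙[v ≤ x] k(v)/v dx = (k(v)/v) ∫_{[v,4]} x^{−s−1} dx`. [folklore] -/
private theorem inner_integral_eq (s : ℂ) {v : ℝ} (hv : 0 < v) :
    ∫ x in Ioc (0 : ℝ) 4, (x : ℂ) ^ (-s - 1) * (tentIntegrand x v : ℂ) =
      ((kern v / v : ℝ) : ℂ) * ∫ x in Icc v 4, (x : ℂ) ^ (-s - 1) := by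
  have hpt : ∀ x : ℝ, (x : ℂ) ^ (-s - 1) * (tentIntegrand x v : ℂ) =
      (Set.Ici v).indicator (fun x : ℝ ↦ (x : ℂ) ^ (-s - 1) * ((kern v / v : ℝ) : ℂ)) x := by
    intro x
    unfold tentIntegrand
    by_cases h : v ≤ x
    · rw [if_pos h, Set.indicator_of_mem (Set.mem_Ici.2 h)]
    · rw [if_neg h, Set.indicator_of_notMem (fun h' ↦ h (Set.mem_Ici.1 h'))]
      simp
  simp_rw [hpt]
  rw [integral_indicator measurableSet_Ici, Measure.restrict_restrict measurableSet_Ici,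
    show Set.Ici v ∩ Ioc 0 4 = Icc v 4 from by
      ext x; simp only [Set.mem_inter_iff, Set.mem_Ici, Set.mem_Ioc, Set.mem_Icc]
      constructor
      · rintro ⟨h1, -, h3⟩; exact ⟨h1, h3⟩
      · rintro ⟨h1, h3⟩; exact ⟨h1, lt_of_lt_of_le hv h1, h3⟩,
    integral_mul_const, mul_comm]

/-- `∫_{[v,4]} x^{−s−1} dx = (4^{−s} − v^{−s})/(−s)` for `0 < v ≤ 4`, `s ≠ 0`. [folklore] -/
private theorem integral_Icc_cpow_eq {s : ℂ} (hs : s ≠ 0) {v : ℝ} (hv : 0 < v) (hv4 : v ≤ 4) :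
    ∫ x in Icc v 4, (x : ℂ) ^ (-s - 1) = (((4 : ℝ) : ℂ) ^ (-s) - (v : ℂ) ^ (-s)) / (-s) := by
  rw [integral_Icc_eq_integral_Ioc, ← intervalIntegral.integral_of_le hv4, integral_cpow]
  · rw [show -s - 1 + 1 = -s by ring]
  · right
    exact ⟨fun h ↦ hs (by linear_combination -h), Set.notMem_uIcc_of_lt hv (by norm_num)⟩

/-- `∫₀^∞ k(v) v^{−s−1} dv = (1 − 2^{−s})/s − (2^{−s} − 4^{−s})/s` (`s ≠ 0`). [folklore] -/
private theorem integral_kern_mul_cpow {s : ℂ} (hs : s ≠ 0) :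
    ∫ v in Ioi (0 : ℝ), (kern v : ℂ) * (v : ℂ) ^ (-s - 1) =
      ((((2 : ℝ) : ℂ) ^ (-s) - 1) / (-s)) - ((((4 : ℝ) : ℂ) ^ (-s) - ((2 : ℝ) : ℂ) ^ (-s)) / (-s)) := by
  have hpt : ∀ v : ℝ, (kern v : ℂ) * (v : ℂ) ^ (-s - 1) =
      (Set.Ico (1 : ℝ) 2).indicator (fun v : ℝ ↦ (v : ℂ) ^ (-s - 1)) v -
        (Set.Ico (2 : ℝ) 4).indicator (fun v : ℝ ↦ (v : ℂ) ^ (-s - 1)) v := by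
    intro v
    unfold kern
    by_cases h1 : v ∈ Set.Ico (1 : ℝ) 2 <;> by_cases h2 : v ∈ Set.Ico (2 : ℝ) 4 <;>
      simp only [Set.indicator_of_mem, Set.indicator_of_notMem, h1, h2, not_false_eq_true] <;>
      push_cast <;> ring
  simp_rw [hpt]
  have hI : ∀ a b : ℝ, 0 < a → a ≤ b →
      ∫ v in Ioi (0 : ℝ), (Set.Ico a b).indicator (fun v : ℝ ↦ (v : ℂ) ^ (-s - 1)) v =
        ((b : ℂ) ^ (-s) - (a : ℂ) ^ (-s)) / (-s) := by
    intro a b ha hab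
    rw [integral_indicator measurableSet_Ico, Measure.restrict_restrict measurableSet_Ico,
      show Set.Ico a b ∩ Ioi 0 = Set.Ico a b from
        Set.inter_eq_left.2 fun v hv ↦ lt_of_lt_of_le ha hv.1,
      integral_Ico_eq_integral_Ioo, ← integral_Ioc_eq_integral_Ioo,
      ← intervalIntegral.integral_of_le hab, integral_cpow]
    · rw [show -s - 1 + 1 = -s by ring]
    · right
      exact ⟨fun h ↦ hs (by linear_combination -h), Set.notMem_uIcc_of_lt ha (lt_of_lt_of_le ha hab)⟩
  have hint : ∀ a b : ℝ, 0 < a → IntegrableOn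
      (fun v : ℝ ↦ (Set.Ico a b).indicator (fun v : ℝ ↦ (v : ℂ) ^ (-s - 1)) v) (Ioi 0) := by
    intro a b ha
    rw [integrableOn_indicator_iff measurableSet_Ico, IntegrableOn,
      show Set.Ico a b ∩ Ioi 0 = Set.Ico a b from
        Set.inter_eq_left.2 fun v hv ↦ lt_of_lt_of_le ha hv.1]
    change IntegrableOn (fun v : ℝ ↦ (v : ℂ) ^ (-s - 1)) (Set.Ico a b)
    refine (ContinuousOn.integrableOn_Icc (fun v hv ↦ ?_)).mono_set Set.Ico_subset_Icc_self
    exact (Complex.continuousAt_ofReal_cpow_const _ _ (Or.inr (lt_of_lt_of_le ha hv.1).ne')).continuousWithinAt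
  rw [integral_sub (hint 1 2 one_pos) (hint 2 4 two_pos), hI 1 2 one_pos (by norm_num),
    hI 2 4 two_pos (by norm_num)]
  push_cast
  rw [Complex.one_cpow]

/-- `∫₀^∞ k(v) dv/v = 0` (`= log 2 − log 2`), complex form. [folklore] -/
private theorem integral_kern_div : ∫ v in Ioi (0 : ℝ), ((kern v / v : ℝ) : ℂ) = 0 := by
  rw [integral_complex_ofReal]
  have h := integral_tentIntegrand_eq_zero (le_refl (4 : ℝ))
  have hpt : ∀ v ∈ Ioi (0 : ℝ), tentIntegrand 4 v = kern v / v := by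
    intro v _
    unfold tentIntegrand
    split_ifs with h4
    · rfl
    · rw [kern_of_four_le (le_of_lt (not_le.1 h4))]; simp
  rw [setIntegral_congr_fun measurableSet_Ioi hpt] at h
  rw [h]
  simp

/-- **`(Gφ₀)^∧(s) = (1 − 2^{−s})²/s²`** for `Re s > −1`, `s ≠ 0` (RH-free): cut the `x`-integral to
`(0,4]` (where `Gφ₀ = T` vanishes beyond), Fubini on `(0,4] × (0,∞)` (integrand bounded by
`𝟙_{[1,4]}(v)`), inner power integrals. [cite: BaezDuarte2005Moebius, §3.1 Lemma 3.4 eq. (3.12) (the transform (Gφ)^∧ of the witness)] -/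
theorem leftMellin_moebiusConv_phi0 {s : ℂ} (hs : -1 < s.re) (hs0 : s ≠ 0) :
    leftMellin (moebiusConv phi0) s = (1 - ((2 : ℝ) : ℂ) ^ (-s)) ^ 2 / s ^ 2 := by
  -- Step 1: `(Gφ₀)^∧(s) = ∫_{(0,4]} x^{−s−1} T(x) dx`
  have hG : ∀ x ∈ Ioi (0 : ℝ), moebiusConv phi0 x = (tent x : ℂ) := fun x hx ↦
    moebiusConv_phi0_eq x (le_of_lt hx)
  have h1 : leftMellin (moebiusConv phi0) s =
      ∫ x in Ioc (0 : ℝ) 4, (x : ℂ) ^ (-s - 1) * (tent x : ℂ) := by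
    unfold leftMellin
    rw [setIntegral_congr_fun measurableSet_Ioi (fun x hx ↦ by rw [hG x hx])]
    refine setIntegral_eq_of_subset_of_forall_sdiff_eq_zero measurableSet_Ioi
      (fun x hx ↦ hx.1) fun x hx ↦ ?_
    have hx4 : 4 < x := by
      by_contra h
      exact hx.2 ⟨hx.1, not_lt.1 h⟩
    rw [tent_eq_zero_of (Or.inr hx4.le)]
    simp
  -- Step 2: write the integrand as an inner integral and swap
  set F : ℝ → ℝ → ℂ := fun x v ↦ (x : ℂ) ^ (-s - 1) * (tentIntegrand x v : ℂ) with hF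
  have h2 : ∀ x : ℝ, (x : ℂ) ^ (-s - 1) * (tent x : ℂ) = ∫ v in Ioi (0 : ℝ), F x v := by
    intro x
    rw [tent, ← integral_complex_ofReal, ← integral_const_mul]
  haveI : Fact (volume (Ioc (0 : ℝ) 4) < ⊤) := ⟨measure_Ioc_lt_top⟩
  have hFint : Integrable (Function.uncurry F)
      ((volume.restrict (Ioc (0 : ℝ) 4)).prod (volume.restrict (Ioi (0 : ℝ)))) := by
    have hmeas : Measurable (Function.uncurry F) :=
      ((Complex.measurable_ofReal.comp measurable_fst).pow_const _).mul
        (Complex.measurable_ofReal.comp measurable_tentIntegrand_uncurry)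
    -- majorant `1 · 𝟙_{[1,4]}(v)`
    have hg : Integrable (fun p : ℝ × ℝ ↦ (1 : ℝ) * (Set.Icc (1 : ℝ) 4).indicator (fun _ ↦ (1 : ℝ)) p.2)
        ((volume.restrict (Ioc (0 : ℝ) 4)).prod (volume.restrict (Ioi (0 : ℝ)))) := by
      refine Integrable.mul_prod (f := fun _ : ℝ ↦ (1 : ℝ))
        (g := fun v : ℝ ↦ (Set.Icc (1 : ℝ) 4).indicator (fun _ ↦ (1 : ℝ)) v) (integrable_const _) ?_
      rw [integrable_indicator_iff measurableSet_Icc]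
      exact integrableOn_const (hs := by
        rw [Measure.restrict_apply measurableSet_Icc]
        exact (measure_mono Set.inter_subset_left).trans_lt measure_Icc_lt_top |>.ne)
    refine Integrable.mono' hg hmeas.aestronglyMeasurable ?_
    rw [Measure.prod_restrict]
    refine (ae_restrict_iff' (measurableSet_Ioc.prod measurableSet_Ioi)).2 (ae_of_all _ ?_)
    rintro ⟨x, v⟩ ⟨hx, hv⟩
    have hx0 : (0 : ℝ) < x := hx.1
    have hv0 : (0 : ℝ) < v := hv
    simp only [Function.uncurry_apply_pair, hF, one_mul]
    rw [norm_mul, Complex.norm_cpow_eq_rpow_re_of_pos hx0, Complex.norm_real, Real.norm_eq_abs]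
    by_cases hk : tentIntegrand x v = 0
    · rw [hk]; simp [Set.indicator_nonneg]
    · -- then `1 ≤ v ≤ x ≤ 4`
      have hvx : v ≤ x := by
        by_contra h; exact hk (by unfold tentIntegrand; rw [if_neg h])
      have hv1 : 1 ≤ v := by
        by_contra h; exact hk (tentIntegrand_eq_zero_of (Or.inl (not_le.1 h)))
      have hv4 : v ≤ 4 := hvx.trans hx.2
      rw [Set.indicator_of_mem (Set.mem_Icc.2 ⟨hv1, hv4⟩)]
      have hx1 : 1 ≤ x := hv1.trans hvx
      have hpow : x ^ ((-s - 1).re) ≤ 1 := by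
        have : (-s - 1).re ≤ 0 := by simp; linarith
        exact Real.rpow_le_one_of_one_le_of_nonpos hx1 this
      calc x ^ ((-s - 1).re) * |tentIntegrand x v| ≤ 1 * 1 :=
            mul_le_mul hpow (abs_tentIntegrand_le_one x v) (abs_nonneg _) zero_le_one
        _ = 1 := one_mul _
  have h3 : ∫ x in Ioc (0 : ℝ) 4, (x : ℂ) ^ (-s - 1) * (tent x : ℂ) =
      ∫ v in Ioi (0 : ℝ), ∫ x in Ioc (0 : ℝ) 4, F x v := by
    rw [setIntegral_congr_fun measurableSet_Ioc (fun x _ ↦ h2 x)]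
    exact integral_integral_swap hFint
  -- Step 3: the inner integrals
  have h4 : ∀ v ∈ Ioi (0 : ℝ), ∫ x in Ioc (0 : ℝ) 4, F x v =
      ((kern v / v : ℝ) : ℂ) * ((((4 : ℝ) : ℂ) ^ (-s) - (v : ℂ) ^ (-s)) / (-s)) := by
    intro v hv
    have hv0 : (0 : ℝ) < v := hv
    rw [hF, inner_integral_eq s hv0]
    by_cases hk : kern v = 0
    · rw [hk]; simp
    · have hv4 : v ≤ 4 := by
        by_contra h; exact hk (kern_of_four_le (le_of_lt (not_le.1 h)))
      rw [integral_Icc_cpow_eq hs0 hv0 hv4]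
  rw [h1, h3, setIntegral_congr_fun measurableSet_Ioi h4]
  -- Step 4: the outer integral
  have h5 : ∀ v ∈ Ioi (0 : ℝ), ((kern v / v : ℝ) : ℂ) * ((((4 : ℝ) : ℂ) ^ (-s) - (v : ℂ) ^ (-s)) / (-s)) =
      s⁻¹ * ((kern v : ℂ) * (v : ℂ) ^ (-s - 1)) - (s⁻¹ * ((4 : ℝ) : ℂ) ^ (-s)) * ((kern v / v : ℝ) : ℂ) := by
    intro v hv
    have hv0 : (0 : ℝ) < v := hv
    have hv' : (v : ℂ) ≠ 0 := Complex.ofReal_ne_zero.2 hv0.ne'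
    rw [Complex.cpow_sub _ _ hv', Complex.cpow_one]
    push_cast
    field_simp
    ring
  rw [setIntegral_congr_fun measurableSet_Ioi h5]
  have hint1 : IntegrableOn (fun v : ℝ ↦ s⁻¹ * ((kern v : ℂ) * (v : ℂ) ^ (-s - 1))) (Ioi 0) := by
    refine Integrable.const_mul ?_ _
    -- bounded by `1` on `[1,4]`, zero outside
    have hmeas : Measurable fun v : ℝ ↦ (kern v : ℂ) * (v : ℂ) ^ (-s - 1) :=
      (Complex.measurable_ofReal.comp measurable_kern).mul (Complex.measurable_ofReal.pow_const _)
    have h1' : IntegrableOn (fun v : ℝ ↦ (kern v : ℂ) * (v : ℂ) ^ (-s - 1)) (Icc 1 4) := by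
      refine Integrable.mono' (integrableOn_const (C := (1 : ℝ)) (hs := measure_Icc_lt_top.ne))
        hmeas.aestronglyMeasurable ?_
      refine ae_restrict_of_forall_mem measurableSet_Icc fun v hv ↦ ?_
      have hv0 : (0 : ℝ) < v := by linarith [hv.1]
      rw [norm_mul, Complex.norm_real, Real.norm_eq_abs, Complex.norm_cpow_eq_rpow_re_of_pos hv0]
      have hpow : v ^ ((-s - 1).re) ≤ 1 := by
        have : (-s - 1).re ≤ 0 := by simp; linarith
        exact Real.rpow_le_one_of_one_le_of_nonpos hv.1 this
      calc |kern v| * v ^ ((-s - 1).re) ≤ 1 * 1 :=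
            mul_le_mul (abs_kern_le_one v) hpow (Real.rpow_nonneg hv0.le _) zero_le_one
        _ = 1 := one_mul _
    have h2' : IntegrableOn (fun v : ℝ ↦ (kern v : ℂ) * (v : ℂ) ^ (-s - 1)) (Ioi 0 \ Icc 1 4) := by
      refine (integrableOn_zero (s := Ioi 0 \ Icc (1 : ℝ) 4)).congr_fun (fun v hv ↦ ?_)
        (measurableSet_Ioi.diff measurableSet_Icc)
      have : v < 1 ∨ 4 < v := by
        by_contra h
        push Not at h
        exact hv.2 ⟨h.1, h.2⟩
      rcases this with h | h
      · rw [kern_of_lt_one h]; simp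
      · rw [kern_of_four_le h.le]; simp
    exact (h1'.union h2').mono_set (fun v hv ↦ by
      by_cases h : v ∈ Icc (1 : ℝ) 4
      · exact Or.inl h
      · exact Or.inr ⟨hv, h⟩)
  have hint2 : IntegrableOn (fun v : ℝ ↦ (s⁻¹ * ((4 : ℝ) : ℂ) ^ (-s)) * ((kern v / v : ℝ) : ℂ)) (Ioi 0) := by
    refine Integrable.const_mul ?_ _
    refine (integrableOn_Ioi_of_bdd_support (f := fun v ↦ kern v / v) (a := 1) (b := 4) (M := 1)
      (measurable_kern.div measurable_id) (fun v _ hv ↦ ?_) (fun v ↦ ?_)).ofReal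
    · rcases hv with h | h
      · rw [kern_of_lt_one h]; simp
      · rw [kern_of_four_le h.le]; simp
    · by_cases hk : kern v = 0
      · rw [hk]; simp
      · have hv1 : 1 ≤ v := by by_contra h; exact hk (kern_of_lt_one (not_le.1 h))
        rw [abs_div, abs_of_pos (by linarith : (0 : ℝ) < v)]
        exact (div_le_one (by linarith)).2 ((abs_kern_le_one v).trans hv1)
  rw [integral_sub hint1 hint2, integral_const_mul, integral_const_mul, integral_kern_mul_cpow hs0,
    integral_kern_div, mul_zero, sub_zero]
  have h4eq : ((4 : ℝ) : ℂ) ^ (-s) = ((2 : ℝ) : ℂ) ^ (-s) * ((2 : ℝ) : ℂ) ^ (-s) := by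
    rw [← Complex.mul_cpow_ofReal_nonneg (by norm_num : (0 : ℝ) ≤ 2) (by norm_num : (0 : ℝ) ≤ 2)]
    norm_num
  rw [h4eq]
  field_simp
  ring

/-- `Gφ₀ ≪ x^{−1/2+ε}` for every `ε` (it vanishes near `+∞`). [folklore] -/
private theorem moebiusConv_phi0_isBigO (e : ℝ) :
    moebiusConv phi0 =O[atTop] fun x : ℝ ↦ x ^ e := by
  refine IsBigO.of_bound 1 ?_
  filter_upwards [eventually_ge_atTop (4 : ℝ)] with x hx
  rw [moebiusConv_phi0_eq_zero hx, norm_zero]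
  positivity

/-- **`φ₀^∧(s) = (1 − 2^{−s})² ζ(s+1)/s` on the strip `−1/2 < Re s < 0`** (RH-free), by Báez-Duarte's
(3.11) `(Gφ)^∧(s) · s ζ(s+1) = φ^∧(s)` for proper `φ` with `Gφ ≪ x^{−1/2+ε}` (tree
`leftMellin_moebiusConv_mul_eq`). [cite: BaezDuarte2005Moebius, §3.1 Lemma 3.4 eq. (3.12) [(3.11) arXiv]] -/
theorem leftMellin_phi0 {s : ℂ} (hs1 : -(1 / 2 : ℝ) < s.re) (hs2 : s.re < 0) :
    leftMellin phi0 s = (1 - ((2 : ℝ) : ℂ) ^ (-s)) ^ 2 * riemannZeta (s + 1) / s := by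
  have hs0 : s ≠ 0 := fun h ↦ by rw [h, Complex.zero_re] at hs2; exact lt_irrefl _ hs2
  have h := BaezDuarteMellin.leftMellin_moebiusConv_mul_eq isMoebiusProper_phi0
    (fun ε _ ↦ moebiusConv_phi0_isBigO _) hs1 hs2
  rw [← h, leftMellin_moebiusConv_phi0 (by linarith) hs0]
  field_simp

/-- `1 − 2^{−s} ≠ 0` for `Re s < 0` (`|2^{−s}| = 2^{−Re s} > 1`). [folklore] -/
private theorem one_sub_two_cpow_neg_ne_zero {s : ℂ} (hs : s.re < 0) : (1 : ℂ) - ((2 : ℝ) : ℂ) ^ (-s) ≠ 0 := by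
  intro h
  have h' : ((2 : ℝ) : ℂ) ^ (-s) = 1 := (sub_eq_zero.1 h).symm
  have hn : ‖((2 : ℝ) : ℂ) ^ (-s)‖ = (2 : ℝ) ^ (-s.re) := by
    rw [Complex.norm_cpow_eq_rpow_re_of_pos two_pos]; simp
  rw [h', norm_one] at hn
  have : (1 : ℝ) < (2 : ℝ) ^ (-s.re) := Real.one_lt_rpow one_lt_two (by linarith)
  linarith

/-- **`φ₀` is Mellin-proper if and only if RH**: on the strip `φ₀^∧(s) = (1−2^{−s})² ζ(s+1)/s`
vanishes exactly at `s = ρ − 1`, `ρ` a zero of `ζ` with `1/2 < Re ρ < 1`.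
[cite: BaezDuarte2005Moebius, §2 (Mellin-proper) and §4 Prop. 4.3] -/
theorem isMellinProper_phi0_iff : IsMellinProper phi0 ↔ RiemannHypothesis := by
  constructor
  · rintro ⟨-, hne⟩
    refine quasiRiemannHypothesis_one_half_iff_holds.1 fun ρ hζ h1 h2 ↦ ?_
    have hs1 : -(1 / 2 : ℝ) < (ρ - 1).re := by simp; linarith
    have hs2 : (ρ - 1).re < 0 := by simp; linarith
    refine hne (ρ - 1) hs1 hs2 ?_
    rw [leftMellin_phi0 hs1 hs2, sub_add_cancel, hζ, mul_zero, zero_div]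
  · intro hRH
    refine ⟨isMoebiusProper_phi0, fun s hs1 hs2 ↦ ?_⟩
    have hs0 : s ≠ 0 := fun h ↦ by rw [h, Complex.zero_re] at hs2; exact lt_irrefl _ hs2
    rw [leftMellin_phi0 hs1 hs2]
    have hζ : riemannZeta (s + 1) ≠ 0 := fun h ↦
      quasiRiemannHypothesis_one_half_iff_holds.2 hRH (s + 1) h
        (by simp; linarith) (by simp; linarith)
    exact div_ne_zero (mul_ne_zero (pow_ne_zero _ (one_sub_two_cpow_neg_ne_zero hs2)) hζ) hs0

/-! ## §7 The line hypotheses of the printed proof fail for `φ₀`: `φ₀^∧(s) = (1 − 2^{−s})² ζ(s+1)/s` on `−1 < Re s < 0`, so `φ₀^∧(ρ − 1) = 0` at every zero `ρ` of `ζ` in the critical strip — unconditionally at the certified first critical zero -/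

/-- The formula `φ₀^∧(s) = (1 − 2^{−s})² ζ(s+1)/s` on the whole strip `−1 < Re s < 0`: both sides are
holomorphic there (`N_σ(φ₀) < ∞` for `σ > −1` and Lemma 2.1 for the left side; `s ≠ 0` for the right
side) and they agree on `−1/2 < Re s < 0` (`leftMellin_phi0`), so they agree on the connected strip.
[cite: BaezDuarte2005Moebius, §2 Lemma 2.1 (holomorphy of `φ^∧`), §3 (3.12)] -/
theorem leftMellin_phi0_eq {s : ℂ} (hs1 : -1 < s.re) (hs2 : s.re < 0) :
    leftMellin phi0 s = (1 - ((2 : ℝ) : ℂ) ^ (-s)) ^ 2 * riemannZeta (s + 1) / s := by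
  set U : Set ℂ := {z : ℂ | (-1 : ℝ) < z.re ∧ z.re < 0} with hU
  have hUo : IsOpen U :=
    (isOpen_lt continuous_const Complex.continuous_re).inter
      (isOpen_lt Complex.continuous_re continuous_const)
  have hUc : IsPreconnected U :=
    ((convex_halfSpace_re_gt (-1 : ℝ)).inter (convex_halfSpace_re_lt (0 : ℝ))).isPreconnected
  have hf : AnalyticOnNhd ℂ (leftMellin phi0) U :=
    (BaezDuarteMellin.differentiableOn_leftMellin measurable_phi0
      (fun σ h1 _ ↦ hasFiniteMellinNorm_phi0 h1)).analyticOnNhd hUo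
  have hg : AnalyticOnNhd ℂ
      (fun z : ℂ ↦ (1 - ((2 : ℝ) : ℂ) ^ (-z)) ^ 2 * riemannZeta (z + 1) / z) U := by
    refine DifferentiableOn.analyticOnNhd (fun z hz ↦ ?_) hUo
    have hz0 : z ≠ 0 := by
      rintro rfl
      have h := hz.2
      rw [Complex.zero_re] at h
      exact lt_irrefl _ h
    have hz1 : z + 1 ≠ 1 := fun h ↦ hz0 (by simpa using h)
    have hζ : DifferentiableAt ℂ (fun w : ℂ ↦ riemannZeta (w + 1)) z :=
      (differentiableAt_riemannZeta hz1).comp z (differentiableAt_id.add_const 1)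
    have h2 : DifferentiableAt ℂ (fun w : ℂ ↦ (1 - ((2 : ℝ) : ℂ) ^ (-w)) ^ 2) z := by
      have h' : DifferentiableAt ℂ (fun w : ℂ ↦ ((2 : ℝ) : ℂ) ^ (-w)) z :=
        differentiableAt_id.neg.const_cpow (Or.inl (Complex.ofReal_ne_zero.2 two_ne_zero))
      exact ((differentiableAt_const _).sub h').pow 2
    exact ((h2.mul hζ).div differentiableAt_id hz0).differentiableWithinAt
  have hz₀ : (-(1 / 4 : ℂ)) ∈ U := by
    refine ⟨?_, ?_⟩ <;> norm_num
  have hfg : leftMellin phi0 =ᶠ[𝓝 (-(1 / 4 : ℂ))]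
      fun z : ℂ ↦ (1 - ((2 : ℝ) : ℂ) ^ (-z)) ^ 2 * riemannZeta (z + 1) / z := by
    have hVo : IsOpen {z : ℂ | -(1 / 2 : ℝ) < z.re ∧ z.re < 0} :=
      (isOpen_lt continuous_const Complex.continuous_re).inter
        (isOpen_lt Complex.continuous_re continuous_const)
    have hmem : (-(1 / 4 : ℂ)) ∈ {z : ℂ | -(1 / 2 : ℝ) < z.re ∧ z.re < 0} := by
      refine ⟨?_, ?_⟩ <;> norm_num
    filter_upwards [hVo.mem_nhds hmem] with z hz
    exact leftMellin_phi0 hz.1 hz.2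
  exact hf.eqOn_of_preconnected_of_eventuallyEq hg hUc hz₀ hfg ⟨hs1, hs2⟩

/-- **At every zero `ρ` of `ζ` in the critical strip, `φ₀^∧(ρ − 1) = 0`.** So under RH the zeros of
`φ₀^∧` accumulate exactly on the line `σ = −1/2` excluded by the Mellin-proper condition, which is why
the printed proof's line hypotheses cannot be dropped. [cite: BaezDuarte2005Moebius, §4 Prop. 4.3 (hypotheses of the printed proof: `φ^∧` on `σ = −1/2`)] -/
theorem leftMellin_phi0_eq_zero_of_riemannZeta_eq_zero {ρ : ℂ} (hζ : riemannZeta ρ = 0)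
    (h0 : 0 < ρ.re) (h1 : ρ.re < 1) : leftMellin phi0 (ρ - 1) = 0 := by
  have hs1 : -1 < (ρ - 1).re := by simp; linarith
  have hs2 : (ρ - 1).re < 0 := by simp; linarith
  rw [leftMellin_phi0_eq hs1 hs2, sub_add_cancel, hζ, mul_zero, zero_div]

/-- **`φ₀` violates the non-vanishing hypothesis of `BaezDuarte2005Moebius_prop_4_3` UNCONDITIONALLY**:
`φ₀^∧` has a zero on the line `Re s = −1/2`, namely at `ρ₀ − 1` for the tree's certified first
critical zero `ρ₀ = 1/2 + iγ₀`, `γ₀ ∈ [225/16, 227/16]` (`exists_zero_Icc_first_bracket`); its other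
extra hypothesis `N_{−1/2}(φ₀) < ∞` does hold (`hasFiniteMellinNorm_phi0`). RH-FREE.
[cite: BaezDuarte2005Moebius, §4 Prop. 4.3 (hypotheses of the printed proof)] -/
theorem exists_leftMellin_phi0_eq_zero_of_re_eq_neg_half :
    HasFiniteMellinNorm phi0 (-(1 / 2 : ℝ)) ∧
      ∃ s : ℂ, s.re = -(1 / 2 : ℝ) ∧ leftMellin phi0 s = 0 := by
  refine ⟨hasFiniteMellinNorm_phi0 (by norm_num), ?_⟩
  obtain ⟨γ, -, hρ⟩ := exists_zero_Icc_first_bracket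
  have hre : ((1 / 2 : ℂ) + (γ : ℂ) * Complex.I).re = 1 / 2 := by simp
  refine ⟨1 / 2 + (γ : ℂ) * Complex.I - 1, ?_, leftMellin_phi0_eq_zero_of_riemannZeta_eq_zero hρ
    (by rw [hre]; norm_num) (by rw [hre]; norm_num)⟩
  rw [Complex.sub_re, hre, Complex.one_re]
  norm_num

/-- Hence the hypothesis-bearing `BaezDuarte2005Moebius_prop_4_3` does not apply to `φ₀`: its
line hypothesis `∀ s, Re s = −1/2 → φ₀^∧(s) ≠ 0` is FALSE (unconditionally). RH-FREE.
[cite: BaezDuarte2005Moebius, §4 Prop. 4.3 (hypotheses of the printed proof)] -/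
theorem not_forall_leftMellin_phi0_ne_zero_of_re_eq_neg_half :
    ¬ ∀ s : ℂ, s.re = -(1 / 2 : ℝ) → leftMellin phi0 s ≠ 0 := by
  obtain ⟨-, s, hs, h0⟩ := exists_leftMellin_phi0_eq_zero_of_re_eq_neg_half
  exact fun h ↦ h s hs h0

end BaezDuarteProp43

open BaezDuarteProp43

/-- **IJMMS Prop. 4.3 as printed is equivalent to `¬RH`.** The printed statement "if `φ` is
Mellin-proper then `Gφ(x) ≠ o(x^{−1/2})`" (for all Mellin-proper `φ`, with no further hypothesis)
holds if RH fails (`BaezDuarte2005Moebius_prop_4_3_of_not_riemannHypothesis`) and FAILS if RH holds: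
`φ₀ = Σ_n k(x/n)/n`, `k = 𝟙_{[1,2)} − 𝟙_{[2,4)}`, is then Mellin-proper (`isMellinProper_phi0_iff`)
with `Gφ₀ ≡ 0` on `[4,∞)`. (The tree's `BaezDuarte2005Moebius_prop_4_3` is the statement WITH the
tacit hypotheses of the printed proof, which `φ₀` violates: `φ₀^∧(−1/2+it) = 0` at the ordinates of
the critical zeros.) FINDING OF RECORD about the printed text; RH is not asserted either way.
[cite: BaezDuarte2005Moebius, §4 Prop. 4.3 (p. 3607, (4.12))] -/
theorem BaezDuarte2005Moebius_prop_4_3_asPrinted_iff_not_riemannHypothesis :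
    (∀ φ : ℝ → ℂ, IsMellinProper φ → ¬ (moebiusConv φ =o[atTop] fun x : ℝ ↦ x ^ (-(1 / 2 : ℝ)))) ↔
      ¬ RiemannHypothesis := by
  constructor
  · intro h hRH
    exact h phi0 (isMellinProper_phi0_iff.2 hRH) moebiusConv_phi0_isLittleO
  · intro hRH φ hφ
    exact BaezDuarte2005Moebius_prop_4_3_of_not_riemannHypothesis hRH hφ

/-- Equivalently: **RH holds iff some Mellin-proper `φ` has `Gφ = o(x^{−1/2})`** (and then `φ₀` is
one). RH-EQUIVALENT. [cite: BaezDuarte2005Moebius, §4 Prop. 4.3 and Thm. 4.1] -/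
theorem riemannHypothesis_iff_exists_isMellinProper_isLittleO :
    RiemannHypothesis ↔
      ∃ φ : ℝ → ℂ, IsMellinProper φ ∧ (moebiusConv φ =o[atTop] fun x : ℝ ↦ x ^ (-(1 / 2 : ℝ))) := by
  constructor
  · exact fun hRH ↦ ⟨phi0, isMellinProper_phi0_iff.2 hRH, moebiusConv_phi0_isLittleO⟩
  · rintro ⟨φ, hφ, h⟩
    exact riemannHypothesis_of_moebiusConv_isBigO_half hφ h.isBigO

end Literature.NumberTheory.LFunctions

end
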